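import Mathlib
import Literature.Probability.Percolation.SmoothedWhiteNoise
import Summits.CriticalPhenomena.CardyFormulaZ2.Theorems.CardyWhiteToColouredDriftBoundStubWhiteEnd

/-!
# Stub stub_whiteWindow — the uniform white window of the noise heat flow (line `birth` of crux `DriftBound`)

Helper file for crux item `DriftBound` (stmt-CriticalPhenomena-4596) of route `CardyWhiteToColoured`
(`CardyFormulaZ2`), stub B1 of the registered line `Cruxes/DriftBound/Lines/birth.lean` (v2).

For a conformal rectangle `R` and `ε > 0` there is `δ₀ > 0` such that for every mesh `δ < δ₀` and
every smoothing scale `0 < s ≤ δ/(1 + |log δ|)` the crossing probability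
`P(s) = smoothedCrossingProb s δ R (arc 0) (arc 2)` of the lattice white noise smoothed at width `s`
is within `ε` of the bond-`ℤ²` crossing probability `bondDomainCrossingProb R δ` at `p = 1/2`:

* both are `latticeWhiteNoise`-probabilities of pull-backs of the same crossing event, by the sign
  configuration of the smoothed field and by the signs `{ξ > 0}` (`latticeWhiteNoise_posSign_preimage`);
  the event only depends on the `≤ 2(2ρ/δ + 3)²` inner edges of `R` (locality,
  `mem_discreteCrossing_iff_of_inter_innerE_eq`, `exists_finset_innerE_subset`), so the difference
  is at most the sum over inner edges `e` of the probability that the sign of the field at `m_δ(e)`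
  differs from the sign of `ξ_e` (union bound);
* **one-edge flip bound**: the field at `m_δ(e)` is `ξ_e + T` with `T = ∑_{e' ≠ e} w_s(e') ξ_{e'}`,
  a flip forces `|ξ_e| ≤ |T|`, so `P(flip) ≤ P(|ξ_e| ≤ t) + P(|T| ≥ t) ≤ t + E|T|/t` (Gaussian density
  `≤ 1/2`, Markov), and `E|T| ≤ E|N(0,1)| ∑_{e' ≠ e} exp(−d(e,e')²/(2s²)) ≤ K exp(−δ²/(16 s²))` since
  distinct medial points are `≥ δ/2` apart and the kernel sum at width `2δ` over the medial lattice
  is bounded uniformly (disjoint cells, as in `tsum_ofReal_gaussWeight_medial_ne_top`);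
* with `t = δ³` and `s ≤ δ/(1 + |log δ|)`, `exp(−δ²/(16 s²)) ≤ δ⁶` once `δ ≤ e^{-94}`, so the total
  is `≤ 2(2ρ + 3)²(1 + K) δ → 0`.

References: S. Muirhead, H. Vanneuville, Ann. Inst. H. Poincaré Probab. Stat. 56 (2020), §2.1;
G. Grimmett, *Percolation* (1999), §1.3.
-/

noncomputable section

namespace Summit.CriticalPhenomena.CardyFormulaZ2.Cruxes.DriftBound.Birth

open Set Filter Topology MeasureTheory ProbabilityTheory
open scoped ENNReal NNReal
open Literature.Probability.LatticeModels Literature.Probability.Percolation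
open Literature.Probability.RandomPlanarGeometry
open Summit.CriticalPhenomena.CardyFormulaZ2.Theorems.WhiteToColoured

/-- `PosSign[ξ]`: the bond configuration `{e ∈ E(ℤ²) | ξ_e > 0}` of positive noise variables. -/
local notation3 "PosSign[" ξ "]" =>
  {e : Sym2 (Site 2) | ∃ h : e ∈ (zdGraph 2).edgeSet, (0 : ℝ) < (ξ : (zdGraph 2).edgeSet → ℝ) ⟨e, h⟩}

/-- `Dg[w] = max |Re w + Im w| |Re w − Im w| = |Re w| + |Im w|`, the rotated sup-distance. -/
local notation3 "Dg[" w "]" => max |Complex.re w + Complex.im w| |Complex.re w - Complex.im w|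

/-! ### Two one-dimensional Gaussian estimates -/

/-- `P(|ξ| ≤ t) ≤ t` for `ξ ∼ N(0,1)`: the density is at most `1/√(2π) ≤ 1/2`. -/
theorem gaussianReal_Icc_le (t : ℝ) : gaussianReal 0 1 (Icc (-t) t) ≤ ENNReal.ofReal t := by
  have hd : ∀ x, gaussianPDF 0 1 x ≤ ENNReal.ofReal (1 / 2) := by
    intro x
    simp only [gaussianPDF, gaussianPDFReal, NNReal.coe_one, mul_one, sub_zero]
    apply ENNReal.ofReal_le_ofReal
    have h2 : (2 : ℝ) ≤ √(2 * Real.pi) := Real.le_sqrt_of_sq_le (by nlinarith [Real.two_le_pi])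
    have h3 : Real.exp (-x ^ 2 / 2) ≤ 1 := Real.exp_le_one_iff.2 (by linarith [sq_nonneg x])
    calc (√(2 * Real.pi))⁻¹ * Real.exp (-x ^ 2 / 2) ≤ 2⁻¹ * 1 :=
          mul_le_mul (inv_anti₀ two_pos h2) h3 (Real.exp_pos _).le (by positivity)
      _ = 1 / 2 := by norm_num
  rw [gaussianReal_apply 0 one_ne_zero]
  calc ∫⁻ x in Icc (-t) t, gaussianPDF 0 1 x ≤ ∫⁻ _ in Icc (-t) t, ENNReal.ofReal (1 / 2) :=
        lintegral_mono fun x => hd x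
    _ = ENNReal.ofReal (1 / 2) * volume (Icc (-t) t) := by
        rw [lintegral_const, Measure.restrict_apply_univ]
    _ = ENNReal.ofReal t := by
        rw [Real.volume_Icc, ← ENNReal.ofReal_mul (by norm_num)]; congr 1; ring

/-- `E|N(0,1)| < ∞`. -/
theorem lintegral_enorm_gaussianReal_ne_top : ∫⁻ t : ℝ, ‖t‖ₑ ∂(gaussianReal 0 1) ≠ ⊤ := by
  have hint : Integrable (id : ℝ → ℝ) (gaussianReal 0 1) :=
    memLp_one_iff_integrable.1 (memLp_id_gaussianReal' 1 ENNReal.one_ne_top)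
  have hfin := hint.hasFiniteIntegral
  rw [HasFiniteIntegral] at hfin
  exact hfin.ne

/-! ### The kernel sum over the medial lattice at width `2δ` is bounded uniformly in `δ` -/

/-- **Uniform kernel-sum bound**: `∑'_{e'} q_{2δ}(x − m_δ e') ≤ 64 √e π / vol{Dg < 1}` for every
mesh `δ > 0` and every point `x` (the cells of `Dg`-radius `δ/2` about the medial points are
disjoint and `q_{2δ}(x − m)` is dominated on the cell of `m` by a Gaussian envelope of mass
`4π(2δ)²√e`; the same chain as `tsum_ofReal_gaussWeight_medial_ne_top`, keeping the constant). -/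
theorem tsum_ofReal_gaussWeight_two_mul_le {δ : ℝ} (hδ : 0 < δ) (x : ℂ) :
    ∑' e : (zdGraph 2).edgeSet, ENNReal.ofReal (gaussWeight (2 * δ) (x - medialPoint δ e.1)) ≤
      ENNReal.ofReal (Real.exp (1 / 2) * Real.pi * 64) / volume {w : ℂ | Dg[w] < 1} := by
  set C : (zdGraph 2).edgeSet → Set ℂ := fun e => {y : ℂ | Dg[y - medialPoint δ e.1] < δ / 2} with hC
  set G : ℂ → ℝ≥0∞ := fun y =>
    ENNReal.ofReal (Real.exp (1 / 2) * Real.exp (-‖y - x‖ ^ 2 / (4 * (2 * δ) ^ 2))) with hG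
  set V₁ : ℝ≥0∞ := volume {w : ℂ | Dg[w] < 1} with hV₁
  set V : ℝ≥0∞ := ENNReal.ofReal ((δ / 2) ^ 2) * V₁ with hV
  have hvol : ∀ e : (zdGraph 2).edgeSet, volume (C e) = V := fun e => volume_cell _ (by positivity)
  have hcell : ∀ e : (zdGraph 2).edgeSet,
      V * ENNReal.ofReal (gaussWeight (2 * δ) (x - medialPoint δ e.1)) ≤ ∫⁻ y in C e, G y := by
    intro e
    rw [← hvol e, mul_comm, ← setLIntegral_const]
    refine setLIntegral_mono' (isOpen_cell _ _).measurableSet fun y hy => ?_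
    apply ENNReal.ofReal_le_ofReal
    refine gaussWeight_le_of_norm_sub_le (by positivity) (by positivity : (0 : ℝ) ≤ δ / 2)
      (by linarith) ?_
    have : Dg[y - medialPoint δ e.1] < δ / 2 := hy
    exact (norm_le_dg _).trans this.le
  have hsum : V * ∑' e : (zdGraph 2).edgeSet, ENNReal.ofReal (gaussWeight (2 * δ) (x - medialPoint δ e.1)) ≤
      ENNReal.ofReal (Real.exp (1 / 2) * (Real.pi * (4 * (2 * δ) ^ 2))) := by
    calc V * ∑' e : (zdGraph 2).edgeSet, ENNReal.ofReal (gaussWeight (2 * δ) (x - medialPoint δ e.1))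
        = ∑' e : (zdGraph 2).edgeSet, V * ENNReal.ofReal (gaussWeight (2 * δ) (x - medialPoint δ e.1)) :=
          ENNReal.tsum_mul_left.symm
      _ ≤ ∑' e : (zdGraph 2).edgeSet, ∫⁻ y in C e, G y := ENNReal.tsum_le_tsum hcell
      _ = ∫⁻ y in ⋃ e : (zdGraph 2).edgeSet, C e, G y := by
          rw [lintegral_iUnion (fun e => (isOpen_cell _ _).measurableSet)]
          intro e e' hne
          exact disjoint_cell hδ e.2 e'.2 fun h => hne (Subtype.ext h)
      _ ≤ ∫⁻ y, G y := lintegral_mono_set (Set.subset_univ _) |>.trans (by rw [Measure.restrict_univ])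
      _ = ENNReal.ofReal (Real.exp (1 / 2) * (Real.pi * (4 * (2 * δ) ^ 2))) := by
          rw [hG]
          simp_rw [ENNReal.ofReal_mul (Real.exp_pos _).le]
          rw [lintegral_const_mul _ (by fun_prop), lintegral_exp_neg_sq_norm_sub_div (by positivity) x,
            ← ENNReal.ofReal_mul (Real.exp_pos _).le]
  rw [ENNReal.le_div_iff_mul_le (Or.inl volume_unitCell_pos.ne') (Or.inl volume_unitCell_lt_top.ne)]
  have h4 : ENNReal.ofReal ((δ / 2) ^ 2) ≠ 0 := (ENNReal.ofReal_pos.2 (by positivity)).ne'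
  refine (ENNReal.mul_le_mul_iff_right h4 ENNReal.ofReal_ne_top).1 ?_
  calc ENNReal.ofReal ((δ / 2) ^ 2) *
        ((∑' e : (zdGraph 2).edgeSet, ENNReal.ofReal (gaussWeight (2 * δ) (x - medialPoint δ e.1))) * V₁)
      = V * ∑' e : (zdGraph 2).edgeSet, ENNReal.ofReal (gaussWeight (2 * δ) (x - medialPoint δ e.1)) := by
        rw [hV]; ring
    _ ≤ ENNReal.ofReal (Real.exp (1 / 2) * (Real.pi * (4 * (2 * δ) ^ 2))) := hsum
    _ = ENNReal.ofReal ((δ / 2) ^ 2) * ENNReal.ofReal (Real.exp (1 / 2) * Real.pi * 64) := by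
        rw [← ENNReal.ofReal_mul (by positivity)]; congr 1; ring

/-! ### The one-edge flip bound -/

/-- **One-edge flip bound.** There is an absolute constant `K` such that for every mesh `δ > 0`,
edge `e`, width `0 < s ≤ δ` and threshold `t > 0`, the probability that the sign of the smoothed
field at `m_δ(e)` differs from the sign of `ξ_e` is at most `t + K exp(−δ²/(16 s²)) / t`: the field
at `m_δ(e)` is `ξ_e + T`, `T = ∑_{e' ≠ e} w_s(e') ξ_{e'}`, a flip forces `|ξ_e| ≤ |T|`, and
`P(|ξ_e| ≤ t) ≤ t` (`gaussianReal_Icc_le`), `P(t ≤ |T|) ≤ E|T|/t` (Markov) with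
`E|T| ≤ E|N(0,1)| e^{−δ²/(16s²)} ∑_{e'} q_{2δ}(m_δ e − m_δ e')` (medial points of distinct edges are
`≥ δ/2` apart, `le_dg_medialPoint_sub`) and the uniform kernel-sum bound
`tsum_ofReal_gaussWeight_two_mul_le`. -/
theorem exists_measureReal_flip_le :
    ∃ K : ℝ, 0 ≤ K ∧ ∀ δ : ℝ, 0 < δ → ∀ e : (zdGraph 2).edgeSet, ∀ s : ℝ, 0 < s → s ≤ δ →
      ∀ t : ℝ, 0 < t →
        latticeWhiteNoise.real {ξ | ¬ (0 < smoothedNoise s δ ξ (medialPoint δ e.1) ↔ 0 < ξ e)} ≤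
          t + K * Real.exp (-δ ^ 2 / (16 * s ^ 2)) / t := by
  set C₁ : ℝ≥0∞ := ∫⁻ t : ℝ, ‖t‖ₑ ∂(gaussianReal 0 1) with hC₁
  set K₂ : ℝ≥0∞ := ENNReal.ofReal (Real.exp (1 / 2) * Real.pi * 64) / volume {w : ℂ | Dg[w] < 1}
    with hK₂
  have hC₁t : C₁ ≠ ⊤ := lintegral_enorm_gaussianReal_ne_top
  have hK₂t : K₂ ≠ ⊤ := ENNReal.div_ne_top ENNReal.ofReal_ne_top volume_unitCell_pos.ne'
  refine ⟨(K₂ * C₁).toReal, ENNReal.toReal_nonneg, fun δ hδ e s hs hsδ t ht => ?_⟩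
  set x : ℂ := medialPoint δ e.1 with hx
  set w : (zdGraph 2).edgeSet → ℝ := fun e' =>
    Real.exp (-(‖x - medialPoint δ e'.1‖ ^ 2) / (2 * s ^ 2)) with hw
  set c : (zdGraph 2).edgeSet → ℝ := fun e' => if e' = e then 0 else w e' with hc
  set G : ((zdGraph 2).edgeSet → ℝ) → ℝ≥0∞ := fun ξ => ∑' e', ‖c e' * ξ e'‖ₑ with hG
  set E₁ : ℝ := Real.exp (-δ ^ 2 / (16 * s ^ 2)) with hE₁
  -- the weights off `e` are small multiples of the kernel at width `2δ`
  have hc0 : ∀ e', 0 ≤ c e' := fun e' => by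
    simp only [hc]; split_ifs; exacts [le_rfl, (Real.exp_pos _).le]
  have hcle : ∀ e', c e' ≤ E₁ * gaussWeight (2 * δ) (x - medialPoint δ e'.1) := by
    intro e'
    simp only [hc]
    split_ifs with h
    · exact mul_nonneg (Real.exp_pos _).le (gaussWeight_pos _ _).le
    · have hne : e.1 ≠ e'.1 := fun h' => h (Subtype.ext h').symm
      have hd : δ ≤ 2 * ‖x - medialPoint δ e'.1‖ :=
        (le_dg_medialPoint_sub hδ e.2 e'.2 hne).trans (dg_le_two_mul_norm _)
      rw [hw, hE₁, gaussWeight, ← Real.exp_add]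
      refine Real.exp_le_exp.2 ?_
      have ha : δ ^ 2 ≤ 4 * ‖x - medialPoint δ e'.1‖ ^ 2 := by nlinarith [norm_nonneg (x - medialPoint δ e'.1)]
      have h1 : δ ^ 2 / (16 * s ^ 2) ≤ ‖x - medialPoint δ e'.1‖ ^ 2 / (4 * s ^ 2) := by
        rw [div_le_div_iff₀ (by positivity) (by positivity)]
        nlinarith [mul_le_mul_of_nonneg_right ha (by positivity : (0 : ℝ) ≤ 4 * s ^ 2)]
      have h2 : ‖x - medialPoint δ e'.1‖ ^ 2 / (2 * (2 * δ) ^ 2) ≤ ‖x - medialPoint δ e'.1‖ ^ 2 / (4 * s ^ 2) :=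
        div_le_div_of_nonneg_left (by positivity) (by positivity) (by nlinarith)
      have h3 : ‖x - medialPoint δ e'.1‖ ^ 2 / (4 * s ^ 2) + ‖x - medialPoint δ e'.1‖ ^ 2 / (4 * s ^ 2) =
          ‖x - medialPoint δ e'.1‖ ^ 2 / (2 * s ^ 2) := by
        rw [← add_div, div_eq_div_iff (by positivity) (by positivity)]; ring
      rw [neg_div, neg_div, neg_div]; linarith
  -- pointwise: the field minus `ξ_e` is dominated by `G`
  have hwe : w e = 1 := by simp [hw, hx]
  have hpt : ∀ ξ : (zdGraph 2).edgeSet → ℝ, ‖smoothedNoise s δ ξ x - ξ e‖ₑ ≤ G ξ := by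
    intro ξ
    by_cases hGt : G ξ = ⊤
    · rw [hGt]; exact le_top
    have hs2 : Summable fun e' => c e' * ξ e' := Summable.of_enorm hGt
    have hupd : Function.update (fun e' => w e' * ξ e') e 0 = fun e' => c e' * ξ e' := by
      funext e'
      rcases eq_or_ne e' e with rfl | h
      · simp [hc]
      · simp [hc, h]
    have hsplit : ∑' e', w e' * ξ e' = w e * ξ e + ∑' e', (if e' = e then 0 else w e' * ξ e') :=
      Summable.tsum_eq_add_tsum_ite' e (by rw [hupd]; exact hs2)
    have hrest : (∑' e', (if e' = e then 0 else w e' * ξ e')) = ∑' e', c e' * ξ e' :=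
      tsum_congr fun e' => by simp only [hc]; split_ifs <;> simp
    have h0 : smoothedNoise s δ ξ x = ∑' e', w e' * ξ e' := rfl
    rw [h0, hsplit, hwe, one_mul, hrest, add_sub_cancel_left]
    exact enorm_tsum_le_tsum_enorm
  -- a flip forces `|ξ_e| ≤ t` or `t ≤ G`
  have hsub : {ξ : (zdGraph 2).edgeSet → ℝ | ¬ (0 < smoothedNoise s δ ξ x ↔ 0 < ξ e)} ⊆
      {ξ | |ξ e| ≤ t} ∪ {ξ | ENNReal.ofReal t ≤ G ξ} := by
    intro ξ hξ
    have hξ' : ¬ (0 < smoothedNoise s δ ξ x ↔ 0 < ξ e) := hξ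
    have hle : |ξ e| ≤ |smoothedNoise s δ ξ x - ξ e| := by
      rcases le_or_gt (ξ e) 0 with h | h
      · have hP : 0 < smoothedNoise s δ ξ x := by
          by_contra hP
          exact hξ' ⟨fun h' => absurd h' hP, fun h' => absurd h' (not_lt.2 h)⟩
        rw [abs_of_nonpos h, abs_of_pos (by linarith)]
        linarith
      · have hP : ¬ 0 < smoothedNoise s δ ξ x := fun hP => hξ' ⟨fun _ => h, fun _ => hP⟩
        rw [abs_of_pos h, abs_of_nonpos (by linarith [not_lt.1 hP])]
        linarith [not_lt.1 hP]
    have hG' : ENNReal.ofReal |ξ e| ≤ G ξ :=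
      calc ENNReal.ofReal |ξ e| ≤ ENNReal.ofReal |smoothedNoise s δ ξ x - ξ e| :=
            ENNReal.ofReal_le_ofReal hle
        _ = ‖smoothedNoise s δ ξ x - ξ e‖ₑ := (Real.enorm_eq_ofReal_abs _).symm
        _ ≤ G ξ := hpt ξ
    rcases le_or_gt |ξ e| t with h1 | h1
    · exact Or.inl h1
    · exact Or.inr ((ENNReal.ofReal_le_ofReal h1.le).trans hG')
  -- the first event: a small ball for `ξ_e`
  have hmp : ∀ e' : (zdGraph 2).edgeSet, MeasurePreserving (fun ξ : (zdGraph 2).edgeSet → ℝ => ξ e')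
      latticeWhiteNoise (gaussianReal 0 1) := fun e' =>
    measurePreserving_eval_infinitePi (fun _ : (zdGraph 2).edgeSet => gaussianReal 0 1) e'
  have hA : latticeWhiteNoise {ξ : (zdGraph 2).edgeSet → ℝ | |ξ e| ≤ t} ≤ ENNReal.ofReal t := by
    have hpre : {ξ : (zdGraph 2).edgeSet → ℝ | |ξ e| ≤ t} =
        (fun ξ : (zdGraph 2).edgeSet → ℝ => ξ e) ⁻¹' Icc (-t) t := by
      ext ξ; simp [abs_le]
    rw [hpre, (hmp e).measure_preimage measurableSet_Icc.nullMeasurableSet]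
    exact gaussianReal_Icc_le t
  -- the second event: Markov for `G`
  have hmeas : ∀ e', Measurable fun ξ : (zdGraph 2).edgeSet → ℝ => ‖c e' * ξ e'‖ₑ := fun e' =>
    (measurable_const.mul (measurable_pi_apply e')).enorm
  have hGint : ∫⁻ ξ, G ξ ∂latticeWhiteNoise ≤ ENNReal.ofReal E₁ * K₂ * C₁ := by
    simp only [hG]
    rw [lintegral_tsum fun e' => (hmeas e').aemeasurable]
    have hle : ∀ e', ∫⁻ ξ, ‖c e' * ξ e'‖ₑ ∂latticeWhiteNoise = ENNReal.ofReal (c e') * C₁ := by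
      intro e'
      have : (fun ξ : (zdGraph 2).edgeSet → ℝ => ‖c e' * ξ e'‖ₑ) =
          fun ξ => ENNReal.ofReal (c e') * ‖ξ e'‖ₑ := by
        funext ξ
        rw [enorm_mul, Real.enorm_eq_ofReal (hc0 e')]
      rw [this, lintegral_const_mul _ (measurable_pi_apply e').enorm, (hmp e').lintegral_comp measurable_enorm]
    simp_rw [hle]
    rw [ENNReal.tsum_mul_right]
    gcongr
    calc ∑' e', ENNReal.ofReal (c e')
        ≤ ∑' e' : (zdGraph 2).edgeSet, ENNReal.ofReal E₁ * ENNReal.ofReal (gaussWeight (2 * δ) (x - medialPoint δ e'.1)) :=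
          ENNReal.tsum_le_tsum fun e' => by
            rw [← ENNReal.ofReal_mul (Real.exp_pos _).le]
            exact ENNReal.ofReal_le_ofReal (hcle e')
      _ = ENNReal.ofReal E₁ * ∑' e' : (zdGraph 2).edgeSet, ENNReal.ofReal (gaussWeight (2 * δ) (x - medialPoint δ e'.1)) :=
          ENNReal.tsum_mul_left
      _ ≤ ENNReal.ofReal E₁ * K₂ := mul_le_mul' le_rfl (tsum_ofReal_gaussWeight_two_mul_le hδ x)
  have ht0 : ENNReal.ofReal t ≠ 0 := (ENNReal.ofReal_pos.2 ht).ne'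
  have hB : latticeWhiteNoise {ξ | ENNReal.ofReal t ≤ G ξ} ≤ ENNReal.ofReal E₁ * K₂ * C₁ / ENNReal.ofReal t :=
    (meas_ge_le_lintegral_div (Measurable.tsum hmeas).aemeasurable ht0 ENNReal.ofReal_ne_top).trans
      (ENNReal.div_le_div_right hGint _)
  have hne : ENNReal.ofReal E₁ * K₂ * C₁ / ENNReal.ofReal t ≠ ⊤ :=
    ENNReal.div_ne_top (ENNReal.mul_ne_top (ENNReal.mul_ne_top ENNReal.ofReal_ne_top hK₂t) hC₁t) ht0
  -- assembly
  calc latticeWhiteNoise.real {ξ | ¬ (0 < smoothedNoise s δ ξ x ↔ 0 < ξ e)}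
      ≤ latticeWhiteNoise.real ({ξ | |ξ e| ≤ t} ∪ {ξ | ENNReal.ofReal t ≤ G ξ}) := measureReal_mono hsub
    _ ≤ latticeWhiteNoise.real {ξ | |ξ e| ≤ t} + latticeWhiteNoise.real {ξ | ENNReal.ofReal t ≤ G ξ} :=
        measureReal_union_le _ _
    _ ≤ t + (K₂ * C₁).toReal * E₁ / t := by
        refine add_le_add (ENNReal.toReal_le_of_le_ofReal ht.le hA) ?_
        rw [measureReal_def]
        calc (latticeWhiteNoise {ξ | ENNReal.ofReal t ≤ G ξ}).toReal
            ≤ (ENNReal.ofReal E₁ * K₂ * C₁ / ENNReal.ofReal t).toReal := ENNReal.toReal_mono hne hB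
          _ = (K₂ * C₁).toReal * E₁ / t := by
              rw [ENNReal.toReal_div, ENNReal.toReal_mul, ENNReal.toReal_mul, ENNReal.toReal_mul,
                ENNReal.toReal_ofReal (Real.exp_pos _).le, ENNReal.toReal_ofReal ht.le]
              ring

/-! ### Assembly -/

/-- **Stub B1 — the uniform white window.** For `δ < δ₀(R, ε)` and all `0 < s ≤ δ/(1 + |log δ|)`
the crossing probability of the lattice model smoothed at width `s` is within `ε` of the bond-`ℤ²`
crossing probability at `p = 1/2`: both are `latticeWhiteNoise`-probabilities of pull-backs of the
crossing event (`latticeWhiteNoise_posSign_preimage`), which only depends on the `≤ 2(2ρ/δ+3)²`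
inner edges (`mem_discreteCrossing_iff_of_inter_innerE_eq`, `exists_finset_innerE_subset`); by the
union bound and the one-edge flip bound `exists_measureReal_flip_le` with `t = δ³` (and
`exp(−δ²/(16 s²)) ≤ δ⁶` for `δ ≤ e^{−94}`), the difference is `≤ 2(2ρ+3)²(1+K) δ`. -/
theorem stub_whiteWindow :
    ∀ R : Literature.Probability.RandomPlanarGeometry.ConformalRectangle, ∀ ε : ℝ, 0 < ε →
      ∃ δ₀ : ℝ, 0 < δ₀ ∧ ∀ δ : ℝ, 0 < δ → δ < δ₀ → ∀ s : ℝ, 0 < s → s ≤ δ / (1 + |Real.log δ|) →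
        |Literature.Probability.Percolation.smoothedCrossingProb s δ R.carrier (R.arc 0) (R.arc 2)
          - Literature.Probability.Percolation.bondDomainCrossingProb R δ| < ε := by
  intro R ε hε
  obtain ⟨K, hK0, hK⟩ := exists_measureReal_flip_le
  obtain ⟨ρ, hΩρ⟩ := (Metric.isBounded_iff_subset_closedBall (0 : ℂ)).1 R.isBounded
  set ρ' : ℝ := max ρ 0 with hρ'
  have hρ'0 : 0 ≤ ρ' := le_max_right _ _
  have hΩ : R.carrier ⊆ Metric.closedBall (0 : ℂ) ρ' :=
    hΩρ.trans (Metric.closedBall_subset_closedBall (le_max_left _ _))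
  set C : ℝ := 2 * (2 * ρ' + 3) ^ 2 * (1 + K) with hC
  have hCpos : 0 < C := by positivity
  refine ⟨min (Real.exp (-94)) (ε / C), lt_min (Real.exp_pos _) (div_pos hε hCpos), ?_⟩
  intro δ hδ hδ₀ s hs hsle
  have hδ94 : δ < Real.exp (-94) := hδ₀.trans_le (min_le_left _ _)
  have hδC : δ * C < ε := (lt_div_iff₀ hCpos).1 (hδ₀.trans_le (min_le_right _ _))
  have hδ1 : δ ≤ 1 := hδ94.le.trans (Real.exp_le_one_iff.2 (by norm_num))
  have hlog : Real.log δ < -94 := by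
    have := Real.log_lt_log hδ hδ94
    rwa [Real.log_exp] at this
  have hL : |Real.log δ| = -Real.log δ := abs_of_neg (by linarith)
  have h1L : 0 < 1 + |Real.log δ| := by positivity
  have hsδ' : s * (1 + |Real.log δ|) ≤ δ := (le_div_iff₀ h1L).1 hsle
  have hsδ : s ≤ δ :=
    le_trans (le_mul_of_one_le_right hs.le (by linarith [abs_nonneg (Real.log δ)])) hsδ'
  -- the exponential factor is `≤ δ⁶`
  have hE : Real.exp (-δ ^ 2 / (16 * s ^ 2)) ≤ δ ^ 6 := by
    rw [show δ ^ 6 = Real.exp (6 * Real.log δ) by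
      rw [show (6 : ℝ) * Real.log δ = ((6 : ℕ) : ℝ) * Real.log δ by norm_num, Real.exp_nat_mul,
        Real.exp_log hδ]]
    refine Real.exp_le_exp.2 ?_
    rw [div_le_iff₀ (by positivity)]
    have hsq : (s * (1 + |Real.log δ|)) ^ 2 ≤ δ ^ 2 := pow_le_pow_left₀ (by positivity) hsδ' 2
    rw [hL] at hsq
    have hpos : 0 ≤ Real.log δ * (Real.log δ + 94) := by nlinarith
    nlinarith [mul_nonneg (sq_nonneg s) hpos, hsq, sq_nonneg s]
  -- the events
  rw [bondDomainCrossingProb_eq_measureReal]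
  unfold smoothedCrossingProb
  set Ev : Set (BondConfig (Site 2)) := discreteCrossing R.carrier δ (R.arc 0) (R.arc 2) with hEv_def
  have hEv : MeasurableSet Ev := measurableSet_discreteCrossing _ _ _ _
  rw [measureReal_def (μ := bondPercolation (zdGraph 2) half), ← latticeWhiteNoise_posSign_preimage hEv,
    ← measureReal_def]
  obtain ⟨I, hI, hIcard⟩ := exists_finset_innerE_subset hρ'0 hΩ hδ
  set Mis : Sym2 (Site 2) → Set ((zdGraph 2).edgeSet → ℝ) := fun e =>
    {ξ | ¬ (e ∈ signConfig s δ ξ ↔ e ∈ PosSign[ξ])} with hMis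
  -- locality: outside the flip events the two pulled-back events agree
  have hloc : ∀ ξ : (zdGraph 2).edgeSet → ℝ, ξ ∉ (⋃ e ∈ I, Mis e) →
      (ξ ∈ signConfig s δ ⁻¹' Ev ↔ ξ ∈ (fun ξ : (zdGraph 2).edgeSet → ℝ => PosSign[ξ]) ⁻¹' Ev) := by
    intro ξ hξ
    simp only [mem_iUnion, not_exists, hMis, mem_setOf_eq, not_not] at hξ
    refine mem_discreteCrossing_iff_of_inter_innerE_eq ?_
    ext e
    simp only [mem_inter_iff]
    constructor
    · rintro ⟨h1, h2⟩
      exact ⟨(hξ e (hI h2)).1 h1, h2⟩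
    · rintro ⟨h1, h2⟩
      exact ⟨(hξ e (hI h2)).2 h1, h2⟩
  have hdiff : ∀ A B : Set ((zdGraph 2).edgeSet → ℝ), (∀ ξ, ξ ∉ (⋃ e ∈ I, Mis e) → (ξ ∈ A ↔ ξ ∈ B)) →
      latticeWhiteNoise.real A - latticeWhiteNoise.real B ≤ latticeWhiteNoise.real (⋃ e ∈ I, Mis e) := by
    intro A B h
    refine le_trans le_measureReal_sdiff (measureReal_mono (fun ξ hξ => ?_) (measure_ne_top _ _))
    by_contra hD
    exact hξ.2 ((h ξ hD).1 hξ.1)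
  -- the flip events are small
  have hflip : ∀ e ∈ I, latticeWhiteNoise.real (Mis e) ≤ (1 + K) * δ ^ 3 := by
    intro e _
    by_cases he : e ∈ (zdGraph 2).edgeSet
    · have hset : Mis e = {ξ | ¬ (0 < smoothedNoise s δ ξ (medialPoint δ e) ↔ 0 < ξ ⟨e, he⟩)} := by
        ext ξ; simp [hMis, mem_signConfig_iff, he]
      rw [hset]
      have hd3 : δ ^ 6 / δ ^ 3 = δ ^ 3 := by rw [div_eq_iff (by positivity)]; ring
      calc latticeWhiteNoise.real {ξ | ¬ (0 < smoothedNoise s δ ξ (medialPoint δ e) ↔ 0 < ξ ⟨e, he⟩)}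
          ≤ δ ^ 3 + K * Real.exp (-δ ^ 2 / (16 * s ^ 2)) / δ ^ 3 :=
            hK δ hδ ⟨e, he⟩ s hs hsδ (δ ^ 3) (by positivity)
        _ ≤ δ ^ 3 + K * δ ^ 6 / δ ^ 3 :=
            add_le_add le_rfl (div_le_div_of_nonneg_right (mul_le_mul_of_nonneg_left hE hK0) (by positivity))
        _ = (1 + K) * δ ^ 3 := by rw [mul_div_assoc, hd3]; ring
    · have hset : Mis e = ∅ := by
        ext ξ; simp [hMis, mem_signConfig_iff, he]
      rw [hset, measureReal_empty]
      positivity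
  have hD : latticeWhiteNoise.real (⋃ e ∈ I, Mis e) ≤ I.card * ((1 + K) * δ ^ 3) :=
    (measureReal_biUnion_finset_le I Mis).trans
      ((Finset.sum_le_sum hflip).trans (by rw [Finset.sum_const, nsmul_eq_mul]))
  have habs : |latticeWhiteNoise.real (signConfig s δ ⁻¹' Ev) -
      latticeWhiteNoise.real ((fun ξ : (zdGraph 2).edgeSet → ℝ => PosSign[ξ]) ⁻¹' Ev)| ≤
        latticeWhiteNoise.real (⋃ e ∈ I, Mis e) :=
    abs_sub_le_iff.2 ⟨hdiff _ _ hloc, hdiff _ _ fun ξ hξ => (hloc ξ hξ).symm⟩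
  have hid : (2 * ρ' / δ + 3) * δ = 2 * ρ' + 3 * δ := by field_simp
  calc |latticeWhiteNoise.real (signConfig s δ ⁻¹' Ev) -
        latticeWhiteNoise.real ((fun ξ : (zdGraph 2).edgeSet → ℝ => PosSign[ξ]) ⁻¹' Ev)|
      ≤ latticeWhiteNoise.real (⋃ e ∈ I, Mis e) := habs
    _ ≤ I.card * ((1 + K) * δ ^ 3) := hD
    _ ≤ 2 * (2 * ρ' / δ + 3) ^ 2 * ((1 + K) * δ ^ 3) := mul_le_mul_of_nonneg_right hIcard (by positivity)
    _ = 2 * ((2 * ρ' / δ + 3) * δ) ^ 2 * (1 + K) * δ := by ring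
    _ = 2 * (2 * ρ' + 3 * δ) ^ 2 * (1 + K) * δ := by rw [hid]
    _ ≤ 2 * (2 * ρ' + 3) ^ 2 * (1 + K) * δ := by
        have h3 : 2 * ρ' + 3 * δ ≤ 2 * ρ' + 3 := by linarith
        have h0 : 0 ≤ 2 * ρ' + 3 * δ := by positivity
        gcongr
    _ = δ * C := by rw [hC]; ring
    _ < ε := hδC

end Summit.CriticalPhenomena.CardyFormulaZ2.Cruxes.DriftBound.Birth

end
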